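import Summits.CriticalPhenomena.PercolationContinuityZ3.Theorems.Transplant.SkelPhiStepINegDefs
import Summits.CriticalPhenomena.PercolationContinuityZ3.Theorems.Transplant.SkelPhiStepINegData
import HarnessLib

/-!
# N1 (the {±1} node), LEVEL 0, file (L0-4b): **STEP I″** — `Skelφ.StepI.exists_stepI_neg`: under the two-axis dictionary with a central inversion at every base
# vertex, `θ(p) > 0`, `0 < p < 1`, (κ) and a.s. uniqueness, for every `δ ∈ (0,1)` and `m₀` there is a record `D : StepI.DataN V` with `Λ = fatSeq` (`= fatSeqOff 0`),
# `R = ψ` (fat radius), seed level `k ≥ max m₀ 1`, `k ≤ M₀`, whose ZONES `(t, M, none)` have probability `> 1 − δ` for all `M ≥ M₀` and whose equilibrium at every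
# `t ∈ types`, `M ≥ M₀`, `n ≥ n₁ M` satisfies the geometric clause `EqGeom` and has all EIGHT piece-links `(t, M, some (n, fam, σ, τ))` of probability `≥ 1 − δ`
# (thresholds uniform over the finitely many types; the equilibrium functions are chosen by `Classical.choice` from `EquilibriumAtW`)

builds on p205010 (kernel theorem, internal audit signed; external expert review pending) — nothing here uses p205010; nothing is claimed about the open node
`SamePDropOfSkeletonNeg`.  Lane `prim-bschramm`, seat `prim-bschramm-p3` (gen 8; design owner); helper file (`--supports stmt-CriticalPhenomena-4575`); NEG-SCOPE §3 (L0-4).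
[cite: MartineauTassion2017, §3.2 Lemma 3.5, §3.3 Lemma 3.7] [cite: KozmaNitzan2024, §4 Lemma 7 (p. 15) (uniqueness zones), p. 17 (Step I)]
-/

noncomputable section

namespace Summit.CriticalPhenomena.PercolationContinuityZ3.Theorems.Transplant

namespace Skelφ

namespace StepI

open MeasureTheory ProbabilityTheory Filter Topology Literature.Probability.Percolation Literature.Probability.LatticeModels SimpleGraph KNLevels
open scoped Classical

variable {V : Type} {G : SimpleGraph V} {φ : V → Site 2}

/-- **The equilibrium thresholds for a GIVEN fat seed** (the proof of `Eq.exists_equilibrium_data` with the seed step removed): `fatSeq t k` (`k ≥ 1`) with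
`P(SEED ↔ ∞) ≥ 1 − (ε/2)³²` admits `M₀ ≥ k` and `n₁ : ℕ → ℕ` with `EquilibriumAtW … M ψ ε n` for `M ≥ M₀`, `n ≥ n₁ M`. [cite: MartineauTassion2017, §3.2 Lemma 3.5] -/
theorem exists_thresholds_of_seed [Countable V] [G.LocallyFinite] {types : Finset V} (hc : G.Preconnected) (hlip : Lip G φ) (hst : Steps G φ)
    (hfr : Frames G φ types) {p : unitInterval} (hC : CylSubcritical G φ types p) (hp0 : 0 < (p : ℝ)) (hp1 : (p : ℝ) < 1)
    (hU : ∀ᵐ ω ∂bondPercolation G p, numInfiniteClusters ω ≤ 1) {t : V} (ht : t ∈ types) {ρ : G ≃g G} (hρt : ρ t = t)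
    (hρφ : ∀ w, φ (ρ w) - φ t = -(φ w - φ t)) {ε : ℝ} (hε0 : 0 < ε) (hε1 : ε < 1) {k : ℕ} (hk1 : 1 ≤ k)
    (hseed : 1 - (ε / 2) ^ 32 ≤ (bondPercolation G p).real (TwoAxis.SeedPerc (↑(fatSeq hfr hC t k) : Set V))) :
    ∃ (M₀ : ℕ) (n₁ : ℕ → ℕ), k ≤ M₀ ∧ ∀ M, M₀ ≤ M → ∀ n, n₁ M ≤ n → EquilibriumAtW G φ p t (fatSeq hfr hC t k) M (fatRadius hfr hC) ε n := by
  set μ := bondPercolation G p with hμ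
  have hε2 : 0 < ε / 2 := by positivity
  have hε21 : ε / 2 < 1 := by linarith
  obtain ⟨m, hm⟩ := exists_pow_lt_of_lt_one hε2 (show (1 / 2 : ℝ) < 1 by norm_num)
  set M₀ : ℕ := max (k + 1) m with hM₀
  have key : ∀ M, ∃ n₁ : ℕ, M₀ ≤ M → ∀ n, n₁ ≤ n → EquilibriumAtW G φ p t (fatSeq hfr hC t k) M (fatRadius hfr hC) ε n := by
    intro M
    by_cases hM : M₀ ≤ M
    swap
    · exact ⟨0, fun h => absurd h hM⟩
    have hkM : k + 1 ≤ M := le_trans (le_max_left _ _) hM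
    have hmM : m ≤ M := le_trans (le_max_right _ _) hM
    have hSM : (↑(fatSeq hfr hC t k) : Set V) ⊆ cyl φ t M := (fatSeq_subset_cyl hfr hC t k).trans (cyl_mono φ t (by omega))
    have hQx : ∀ σu : ℤˣ, Eq.MeetsAS G p (Eq.Xinf φ t (σu : ℤ) (M + 3))ᶜ := fun σu =>
      meetsAS_compl_Xinf hc hfr hst hlip hU t (by rcases Int.units_eq_one_or σu with h | h <;> simp [h]) (M + 3)
    have htail : ∀ L, M ≤ L → μ.real (⋃ b ∈ fatSeq hfr hC t k, cylReach G φ t L (fatRadius hfr hC L - 1) b) ≤ ε / 2 := by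
      intro L hL
      have h1 := real_biUnion_cylReach_fat_le hfr hC ht (n := L) (by omega) (Eq.fatSeq_subset_fatSeq hfr hC t (show k ≤ L - 1 by omega))
      have h2 : (1 / 2 : ℝ) ^ L ≤ (1 / 2) ^ m := pow_le_pow_of_le_one (by norm_num) (by norm_num) (by omega)
      linarith
    obtain ⟨n₁, hn₁⟩ := Eq.exists_equilibriumW (t := t) hlip hst hfr hC hp0 hp1 hρt hρφ (M := M) (by omega) (fatSeq hfr hC t k)
      ((mem_fatSeq_iff hfr hC).2 (self_mem_cylBall G φ t k _)) hSM (Eq.preimage_fatSeq_of_neg hfr hC hρt hρφ k)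
      (fun n => meetsAS_compl_strip hc hfr hst hlip hU t n) hQx hε2 hε21 hseed (fatRadius hfr hC)
      (fun L hL => le_trans (by omega) (le_fatRadius hfr hC L))
      (fun L hL v hv => cylBall_mono G φ t (by omega) (fatRadius_mono hfr hC (by omega)) ((mem_fatSeq_iff hfr hC).1 (Finset.mem_coe.1 hv)))
      htail
    refine ⟨n₁, fun _ n hn => ?_⟩
    have := hn₁ n hn
    rwa [add_halves] at this
  choose n₁ hn₁ using key
  exact ⟨M₀, n₁, le_trans (Nat.le_succ _) (le_max_left _ _), fun M hM n hn => hn₁ M hM n hn⟩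

/-- The equilibrium triple chosen at `(t, M, n)` (default `(0, 0, 0)` where no equilibrium is recorded). [this work] -/
def eqTriple (G : SimpleGraph V) [G.LocallyFinite] (φ : V → Site 2) (p : unitInterval) (SEED : V → Finset V) (R : ℕ → ℕ) (ε : ℝ) (t : V) (M n : ℕ) :
    ℤ × ℕ × ℤ :=
  if H : EquilibriumAtW G φ p t (SEED t) M R ε n then (H.choose, H.choose_spec.choose, H.choose_spec.choose_spec.choose) else (0, 0, 0)

/-- **STEP I″ OF THE {±1} NODE.** [cite: MartineauTassion2017, §3.3 Lemma 3.7] [cite: KozmaNitzan2024, §4 p. 17 (Step I)] -/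
theorem exists_stepI_neg [Countable V] [G.LocallyFinite] {types : Finset V} (hc : G.Preconnected) (hlip : Lip G φ) (hst : Steps G φ)
    (hfr : Frames G φ types) (hκ : CylConn G φ types) {p : unitInterval} (hC : CylSubcritical G φ types p) (hp0 : 0 < (p : ℝ)) (hp1 : (p : ℝ) < 1)
    (hU : ∀ᵐ ω ∂bondPercolation G p, numInfiniteClusters ω ≤ 1) {z : V} (hθ : 0 < theta G z p)
    (hneg : ∀ t ∈ types, ∃ ρ : G ≃g G, ρ t = t ∧ ∀ w, φ (ρ w) - φ t = -(φ w - φ t)) {δ : ℝ} (hδ0 : 0 < δ) (hδ1 : δ < 1) (m₀ : ℕ) :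
    ∃ D : DataN V, m₀ ≤ D.k ∧ 1 ≤ D.k ∧ D.k ≤ D.M₀ ∧ D.R = fatRadius hfr hC ∧ D.Λ = fatSeq hfr hC ∧
      (∀ t ∈ types, ∀ M, D.M₀ ≤ M → 1 - δ < (bondPercolation G p).real (eventN G φ D (t, M, none))) ∧
      (∀ t ∈ types, ∀ M, D.M₀ ≤ M → ∀ n, D.n₁ M ≤ n →
        D.EqGeom G φ t M n ∧ ∀ (fam : Fin 2) (σ τ : ℤˣ), 1 - δ ≤ (bondPercolation G p).real (eventN G φ D (t, M, some (n, fam, σ, τ)))) := by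
  set μ := bondPercolation G p with hμ
  -- one seed level for all base vertices
  obtain ⟨k, hkm, hk⟩ := exists_seed_scale hfr hC hκ hθ (η := (δ / 2) ^ 32) (by positivity) (max m₀ 1)
  have hk1 : 1 ≤ k := le_trans (le_max_right _ _) hkm
  have hseed : ∀ t ∈ types, 1 - (δ / 2) ^ 32 ≤ μ.real (TwoAxis.SeedPerc (↑(fatSeq hfr hC t k) : Set V)) := fun t ht => by
    have := hk t ht 0; rw [fatSeqOff_zero] at this; exact this.le
  -- per-type thresholds
  have hthr : ∀ t, ∃ (M₀ : ℕ) (n₁ : ℕ → ℕ), t ∈ types → k ≤ M₀ ∧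
      ∀ M, M₀ ≤ M → ∀ n, n₁ M ≤ n → EquilibriumAtW G φ p t (fatSeq hfr hC t k) M (fatRadius hfr hC) δ n := by
    intro t
    by_cases ht : t ∈ types
    · obtain ⟨ρ, hρt, hρφ⟩ := hneg t ht
      obtain ⟨M₀, n₁, hkM, h⟩ := exists_thresholds_of_seed hc hlip hst hfr hC hp0 hp1 hU ht hρt hρφ hδ0 hδ1 hk1 (hseed t ht)
      exact ⟨M₀, n₁, fun _ => ⟨hkM, h⟩⟩
    · exact ⟨0, fun _ => 0, fun h => absurd h ht⟩
  choose M₀ n₁ hthr using hthr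
  -- per-type zone thresholds
  have hzone : ∀ t, ∃ Mz : ℕ, t ∈ types → ∀ M, Mz ≤ M → 1 - δ < μ.real (UniqZone.zone G (fatSeq hfr hC t) k M) := by
    intro t
    by_cases ht : t ∈ types
    · obtain ⟨Mz, hMz⟩ := UniqZone.exists_forall_le_lt_real_zone p hU (fatSeq_nest hlip hfr hC t) (fatSeq_monotone hfr hC t)
        (fatSeq_exhaust hκ hfr hC ht) k hδ0
      exact ⟨Mz, fun _ => hMz⟩
    · exact ⟨0, fun h => absurd h ht⟩
  choose Mz hMz using hzone
  -- the record
  set T : V → ℕ → ℕ → ℤ × ℕ × ℤ := eqTriple G φ p (fun t => fatSeq hfr hC t k) (fatRadius hfr hC) δ with hT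
  set D : DataN V := ⟨fatSeq hfr hC, k, fatRadius hfr hC, types.sup M₀ + types.sup Mz + k, fun M => types.sup fun t => n₁ t M,
    fun t M n => (T t M n).1, fun t M n => (T t M n).2.1, fun t M n => (T t M n).2.2⟩ with hD
  refine ⟨D, le_trans (le_max_left _ _) hkm, hk1, Nat.le_add_left _ _, rfl, rfl, fun t ht M hM => ?_, fun t ht M hM n hn => ?_⟩
  · rw [eventN_none]
    exact hMz t ht M (le_trans (le_trans (Finset.le_sup (f := Mz) ht) (Nat.le_add_left _ _)) (le_trans (Nat.le_add_right _ _) hM))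
  · have hM' : M₀ t ≤ M := le_trans (le_trans (Finset.le_sup (f := M₀) ht) (Nat.le_add_right _ _)) (le_trans (Nat.le_add_right _ _) hM)
    have hn' : n₁ t M ≤ n := le_trans (Finset.le_sup (f := fun t => n₁ t M) ht) hn
    have H : EquilibriumAtW G φ p t (fatSeq hfr hC t k) M (fatRadius hfr hC) δ n := ((hthr t ht).2 M hM' n hn')
    have hTe : T t M n = (H.choose, H.choose_spec.choose, H.choose_spec.choose_spec.choose) := by rw [hT, eqTriple, dif_pos H]
    have hs := H.choose_spec.choose_spec.choose_spec
    have h1 : D.hgt t M n = H.choose := by simp only [hD, hTe]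
    have h2 : D.len t M n = H.choose_spec.choose := by simp only [hD, hTe]
    have h3 : D.spl t M n = H.choose_spec.choose_spec.choose := by simp only [hD, hTe]
    refine DataN.eqGeom_and_links ?_
    rw [regionN, DataN.scale, h1, h2, h3]
    exact hs

/-- **STEP I″ over a finite index set** (strict inequalities, the shape the choice file transports to a running density): zone sizes `Sz` above `M₀` and widths
`Sn` above `n₁ M` for every `M ∈ Sz`. [cite: KozmaNitzan2024, §4 p. 17 (Step I)] -/
theorem exists_stepI_neg_index [Countable V] [G.LocallyFinite] {types : Finset V} (hc : G.Preconnected) (hlip : Lip G φ) (hst : Steps G φ)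
    (hfr : Frames G φ types) (hκ : CylConn G φ types) {p : unitInterval} (hC : CylSubcritical G φ types p) (hp0 : 0 < (p : ℝ)) (hp1 : (p : ℝ) < 1)
    (hU : ∀ᵐ ω ∂bondPercolation G p, numInfiniteClusters ω ≤ 1) {z : V} (hθ : 0 < theta G z p)
    (hneg : ∀ t ∈ types, ∃ ρ : G ≃g G, ρ t = t ∧ ∀ w, φ (ρ w) - φ t = -(φ w - φ t)) {δ : ℝ} (hδ0 : 0 < δ) (hδ1 : δ < 1) (m₀ : ℕ) :
    ∃ D : DataN V, m₀ ≤ D.k ∧ 1 ≤ D.k ∧ D.k ≤ D.M₀ ∧ D.R = fatRadius hfr hC ∧ D.Λ = fatSeq hfr hC ∧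
      (∀ t ∈ types, ∀ M, D.M₀ ≤ M → ∀ n, D.n₁ M ≤ n → D.EqGeom G φ t M n) ∧
      ∀ Sz Sn : Finset ℕ, (∀ M ∈ Sz, D.M₀ ≤ M) → (∀ M ∈ Sz, ∀ n ∈ Sn, D.n₁ M ≤ n) →
        ∀ i ∈ indexN types Sz Sn, 1 - δ < (bondPercolation G p).real (eventN G φ D i) := by
  obtain ⟨D, h1, h2, h3, h4, h5, hz, he⟩ := exists_stepI_neg hc hlip hst hfr hκ hC hp0 hp1 hU hθ hneg (δ := δ / 2) (by positivity) (by linarith) m₀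
  refine ⟨D, h1, h2, h3, h4, h5, fun t ht M hM n hn => (he t ht M hM n hn).1, fun Sz Sn hSz hSn i hi => ?_⟩
  obtain ⟨ht, hM, hog⟩ := of_mem_indexN hi
  obtain ⟨t, M, og⟩ := i
  simp only at ht hM hog
  rcases hog with rfl | ⟨n, hn, fam, σ, τ, rfl⟩
  · have := hz t ht M (hSz M hM); linarith
  · have := ((he t ht M (hSz M hM) n (hSn M hM n hn)).2 fam σ τ); linarith

/-- **Unpacking the inputs at a running density `q`** (index bookkeeping only). [folklore] -/
theorem unpackN [Countable V] [G.LocallyFinite] {types : Finset V} (D : DataN V) {Sz Sn : Finset ℕ} {q : unitInterval} {δ : ℝ}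
    (h : ∀ i ∈ indexN types Sz Sn, 1 - δ < (bondPercolation G q).real (eventN G φ D i)) {t : V} (ht : t ∈ types) :
    (∀ M ∈ Sz, 1 - δ < (bondPercolation G q).real (UniqZone.zone G (D.Λ t) D.k M)) ∧
      ∀ M ∈ Sz, ∀ n ∈ Sn, ∀ (fam : Fin 2) (σ τ : ℤˣ),
        1 - δ < (bondPercolation G q).real (linkIn (regionN G φ D t M n) (D.Λ t D.k) (pieceN G φ D t M n fam σ τ)) :=
  ⟨fun _ hM => h _ (mem_indexN_none ht hM), fun _ hM _ hn fam σ τ => h _ (mem_indexN_some ht hM hn fam σ τ)⟩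

end StepI

end Skelφ

end Summit.CriticalPhenomena.PercolationContinuityZ3.Theorems.Transplant

end
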